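import Summits.HodgeConjecture.CorCM.NonGaloisSexticCMFrame
import HarnessLib

/-!
# COR-CM — TWO non-Galois sextic fields over one quadratic field: the six permutations of the `τ`-fibres are
# realised JOINTLY by automorphisms of `ℂ` (Goursat in `S₃ × S₃`)

Cell `pub-hodgecm2` (COR-CM), seat b30 gen 16 (2026-08-21); COUNT-NEUTRAL; theorems only, no definition, no named fact,
no `sorry`.  Fourth file of the series TWO-FIELD-PAIR: it supplies the JOINT Galois hypothesis `he_gal` of
`TwoSexticFields.hodgeConjectureFor_biproduct_comp_of_frames_of_markman` (`CorCM/TwoSexticFieldsPowersHodgeOfMarkman.lean`).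

SETTING.  `k` a field with `τ : k → ℂ`, `τ̄ ≠ τ`; two CM number fields `K₁ ⊇ i₁(k)`, `K₂ ⊇ i₂(k)` of degree `6` whose
complex embeddings restrict to `τ` or `τ̄`, with enumerations `t_m : ℤ/3 → Hom(K_m, ℂ)` of the two `τ`-fibres
(injective, onto the fibre).  An automorphism `σ` of `ℂ` fixing `τ` permutes both fibres: `σ ∘ t_m p = t_m (π_m p)`;
write `J π₁ π₂` for «some `σ` realises `(π₁, π₂)`».  The realised pairs form a subgroup `H ≤ S₃ × S₃`, and the question
is whether `H` contains the DIAGONAL `{(π, π)}`.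

* §1 Kernel lemmas on `S₃ = Perm(ℤ/3)` (`decide`): every element is a cube root of `1` or a transposition; a normal
  submonoid with a non-trivial element contains the cube roots of `1` (`A₃`), and with a transposition is everything;
  if `c⁻¹ a` is a transposition then exactly one of `a`, `c` is (sign bookkeeping without signs).
* §2 **`forall_diag_of_subdirect`** — Goursat for `S₃ × S₃`, abstractly: a relation `J` on `S₃ × S₃` containing `(1,1)`,
  closed under products, with both projections onto (`∀ a ∃ c, J a c`, `∀ c ∃ a, J a c`) and both «kernels» non-trivial
  (`J a 1` for some `a ≠ 1`, `J 1 c` for some `c ≠ 1`) contains the diagonal: the kernels are normal, hence contain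
  `A₃`, so `H ⊇ A₃ × A₃`, and `H / (A₃ × A₃) ≤ C₂ × C₂` is subdirect, i.e. the sign-diagonal or everything
  [cite: Lang2002, I §12 Exercise 5 (Goursat's lemma)];
* §3 **`exists_ringEquiv_forall_comp_eq_perm₂`** — for two NON-Galois sextic fields `K₁`, `K₂` over `(k, τ)` such that
  the stabiliser in `Aut(ℂ)` of all of `Hom(K₂, ℂ)` moves some embedding of `K₁` and vice versa (`hsep₁`, `hsep₂` —
  «`K₁^{gal} ⊄ K₂^{gal}` and `K₂^{gal} ⊄ K₁^{gal}`», automatic for non-isomorphic sextic CM fields sharing `k`, see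
  `CorCM/TwoSexticFieldsThreefoldPairHodgeOfMarkman.lean`), EVERY permutation `π` of `ℤ/3` is realised on both fibres
  by ONE automorphism of `ℂ`: `σ ∘ t₁ p = t₁ (π p)` and `σ ∘ t₂ p = t₂ (π p)`.  The single-field case is gen 14's
  `NonGaloisField.exists_ringEquiv_forall_comp_eq_perm` (both projections of `H` are onto); `hsep_m` are the
  non-trivial kernels [cite: Lang2002, VI §1 Thm. 1.14] [cite: Shimura1998, §18.2 Lemma (i)];
* §4 `exists_joint_he_gal` — the frame form: for frames `e_m` with `e_m (t_m p) = (p, true)`, `e_m (t_m p‾) = (p, false)`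
  the six sign-preserving moves `(p, b) ↦ (±p + j, b)` are realised jointly (the hypothesis `he_gal` of the two-field
  assembly).

## References
* [Lang2002] S. Lang, *Algebra*, 3rd ed., I §12 Exercise 5 (Goursat), VI §1 Thm. 1.14.
* [Shimura1998] G. Shimura, *Abelian Varieties with Complex Multiplication and Modular Functions* (1998), §18.2.
-/

noncomputable section

namespace Summit.HodgeConjecture.CorCM.TwoSexticFields

open NumberField
open Summit.HodgeConjecture.CorCM.NonGaloisField

/-! ## §1 Kernel lemmas on `S₃` (no classical instances in this section: `decide`) -/

section Kernel

/-- Every element of `S₃` is a cube root of `1` or a transposition. [folklore] -/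
theorem perm_cube_or_transposition :
    ∀ x : Equiv.Perm (ZMod 3), x * x * x = 1 ∨ (x * x = 1 ∧ x ≠ 1) := by
  decide +kernel

/-- In `S₃`, `x⁵ = x⁻¹`. [folklore] -/
theorem perm_pow_five_eq_inv : ∀ x : Equiv.Perm (ZMod 3), x * x * x * x * x = x⁻¹ := by
  decide +kernel

set_option synthInstance.maxSize 4096 in
set_option synthInstance.maxHeartbeats 400000 in
/-- If `c⁻¹ a` is a transposition then exactly one of `a`, `c` is a transposition and the other a cube root of `1`
(the sign is multiplicative). [folklore] -/
theorem perm_transposition_split : ∀ a c : Equiv.Perm (ZMod 3),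
    c⁻¹ * a * (c⁻¹ * a) = 1 → c⁻¹ * a = 1 ∨
      (a * a = 1 ∧ a ≠ 1 ∧ c * c * c = 1) ∨ (a * a * a = 1 ∧ c * c = 1 ∧ c ≠ 1) := by
  decide +kernel

set_option maxRecDepth 8000 in
set_option maxHeartbeats 4000000 in
set_option synthInstance.maxSize 4096 in
set_option synthInstance.maxHeartbeats 400000 in
/-- **A normal submonoid of `S₃` with a non-trivial element contains `A₃`** (the cube roots of `1`). [folklore] -/
theorem perm_normal_subsets_cubes :
    ∀ N : Finset (Equiv.Perm (ZMod 3)), ((1 : Equiv.Perm (ZMod 3)) ∈ N ∧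
      (∀ a ∈ N, ∀ b ∈ N, b * a ∈ N) ∧ (∀ a ∈ N, ∀ g : Equiv.Perm (ZMod 3), g * a * g⁻¹ ∈ N) ∧
      (∃ a ∈ N, a ≠ 1)) → ∀ c : Equiv.Perm (ZMod 3), c * c * c = 1 → c ∈ N := by
  decide +kernel

set_option maxRecDepth 8000 in
set_option maxHeartbeats 4000000 in
set_option synthInstance.maxSize 4096 in
set_option synthInstance.maxHeartbeats 400000 in
/-- **A normal submonoid of `S₃` containing a transposition is `S₃`.** [folklore] -/
theorem perm_normal_subsets_univ :
    ∀ N : Finset (Equiv.Perm (ZMod 3)), ((1 : Equiv.Perm (ZMod 3)) ∈ N ∧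
      (∀ a ∈ N, ∀ b ∈ N, b * a ∈ N) ∧ (∀ a ∈ N, ∀ g : Equiv.Perm (ZMod 3), g * a * g⁻¹ ∈ N) ∧
      (∃ a ∈ N, a ≠ 1 ∧ a * a = 1)) → ∀ c : Equiv.Perm (ZMod 3), c ∈ N := by
  decide +kernel

end Kernel

open scoped Classical

/-! ## §2 Goursat for `S₃ × S₃`: a subdirect relation with non-trivial kernels contains the diagonal -/

section Goursat

variable {J : Equiv.Perm (ZMod 3) → Equiv.Perm (ZMod 3) → Prop}
  (h1 : J 1 1) (hmul : ∀ a c a' c', J a c → J a' c' → J (a' * a) (c' * c))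

include h1 hmul in
/-- Powers of a realised pair are realised. [folklore] -/
theorem goursat_pow {a c : Equiv.Perm (ZMod 3)} (h : J a c) : ∀ n : ℕ, J (a ^ n) (c ^ n)
  | 0 => by simpa using h1
  | n + 1 => by
    have := hmul _ _ _ _ (goursat_pow h n) h
    rwa [← pow_succ', ← pow_succ'] at this

include h1 hmul in
/-- Inverses of a realised pair are realised (`x⁻¹ = x⁵` in `S₃`). [folklore] -/
theorem goursat_inv {a c : Equiv.Perm (ZMod 3)} (h : J a c) : J a⁻¹ c⁻¹ := by
  have h5 := goursat_pow h1 hmul h 5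
  rw [show a ^ 5 = a * a * a * a * a by simp [pow_succ, mul_assoc],
    show c ^ 5 = c * c * c * c * c by simp [pow_succ, mul_assoc], perm_pow_five_eq_inv, perm_pow_five_eq_inv] at h5
  exact h5

variable (hfst : ∀ a, ∃ c, J a c) (hsnd : ∀ c, ∃ a, J a c)

include h1 hmul hfst in
/-- The left kernel `{a | J a 1}` is a normal submonoid of `S₃`. [cite: Lang2002, I §12 Exercise 5] -/
theorem goursat_leftKernel_normal :
    (1 : Equiv.Perm (ZMod 3)) ∈ (Finset.univ.filter fun a => J a 1) ∧
      (∀ a ∈ (Finset.univ.filter fun a => J a 1), ∀ b ∈ (Finset.univ.filter fun a => J a 1),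
        b * a ∈ (Finset.univ.filter fun a => J a 1)) ∧
      (∀ a ∈ (Finset.univ.filter fun a => J a 1), ∀ g : Equiv.Perm (ZMod 3),
        g * a * g⁻¹ ∈ (Finset.univ.filter fun a => J a 1)) := by
  refine ⟨by simpa using h1, fun a ha b hb => ?_, fun a ha g => ?_⟩
  · simp only [Finset.mem_filter, Finset.mem_univ, true_and] at ha hb ⊢
    simpa using hmul _ _ _ _ ha hb
  · simp only [Finset.mem_filter, Finset.mem_univ, true_and] at ha ⊢
    obtain ⟨c, hc⟩ := hfst g
    have h := hmul _ _ _ _ (hmul _ _ _ _ (goursat_inv h1 hmul hc) ha) hc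
    simpa [mul_assoc] using h

include h1 hmul hsnd in
/-- The right kernel `{c | J 1 c}` is a normal submonoid of `S₃`. [cite: Lang2002, I §12 Exercise 5] -/
theorem goursat_rightKernel_normal :
    (1 : Equiv.Perm (ZMod 3)) ∈ (Finset.univ.filter fun c => J 1 c) ∧
      (∀ a ∈ (Finset.univ.filter fun c => J 1 c), ∀ b ∈ (Finset.univ.filter fun c => J 1 c),
        b * a ∈ (Finset.univ.filter fun c => J 1 c)) ∧
      (∀ a ∈ (Finset.univ.filter fun c => J 1 c), ∀ g : Equiv.Perm (ZMod 3),
        g * a * g⁻¹ ∈ (Finset.univ.filter fun c => J 1 c)) := by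
  refine ⟨by simpa using h1, fun a ha b hb => ?_, fun a ha g => ?_⟩
  · simp only [Finset.mem_filter, Finset.mem_univ, true_and] at ha hb ⊢
    simpa using hmul _ _ _ _ ha hb
  · simp only [Finset.mem_filter, Finset.mem_univ, true_and] at ha ⊢
    obtain ⟨b, hb⟩ := hsnd g
    have h := hmul _ _ _ _ (hmul _ _ _ _ (goursat_inv h1 hmul hb) ha) hb
    simpa [mul_assoc] using h

include h1 hmul hfst hsnd in
/-- **GOURSAT FOR `S₃ × S₃` (the form used here).**  A relation `J ⊆ S₃ × S₃` containing `(1,1)`, closed under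
products, with both projections onto and both kernels non-trivial contains the diagonal `{(a, a)}`.
[cite: Lang2002, I §12 Exercise 5] -/
theorem forall_diag_of_subdirect (hN₁ : ∃ a, a ≠ 1 ∧ J a 1) (hN₂ : ∃ c, c ≠ 1 ∧ J 1 c) : ∀ a, J a a := by
  -- the kernels contain `A₃`
  have hK₁ : ∀ x : Equiv.Perm (ZMod 3), x * x * x = 1 → J x 1 := by
    intro x hx
    obtain ⟨a, ha1, ha⟩ := hN₁
    have h := perm_normal_subsets_cubes _ ⟨(goursat_leftKernel_normal h1 hmul hfst).1,
      (goursat_leftKernel_normal h1 hmul hfst).2.1, (goursat_leftKernel_normal h1 hmul hfst).2.2,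
      ⟨a, by simpa using ha, ha1⟩⟩ x hx
    simpa using h
  have hK₂ : ∀ x : Equiv.Perm (ZMod 3), x * x * x = 1 → J 1 x := by
    intro x hx
    obtain ⟨c, hc1, hc⟩ := hN₂
    have h := perm_normal_subsets_cubes _ ⟨(goursat_rightKernel_normal h1 hmul hsnd).1,
      (goursat_rightKernel_normal h1 hmul hsnd).2.1, (goursat_rightKernel_normal h1 hmul hsnd).2.2,
      ⟨c, by simpa using hc, hc1⟩⟩ x hx
    simpa using h
  -- a transposition in a kernel makes that kernel everything
  have hU₁ : ∀ a : Equiv.Perm (ZMod 3), a ≠ 1 → a * a = 1 → J a 1 → ∀ x, J x 1 := by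
    intro a ha1 haa ha x
    have h := perm_normal_subsets_univ _ ⟨(goursat_leftKernel_normal h1 hmul hfst).1,
      (goursat_leftKernel_normal h1 hmul hfst).2.1, (goursat_leftKernel_normal h1 hmul hfst).2.2,
      ⟨a, by simpa using ha, ha1, haa⟩⟩ x
    simpa using h
  have hU₂ : ∀ c : Equiv.Perm (ZMod 3), c ≠ 1 → c * c = 1 → J 1 c → ∀ x, J 1 x := by
    intro c hc1 hcc hc x
    have h := perm_normal_subsets_univ _ ⟨(goursat_rightKernel_normal h1 hmul hsnd).1,
      (goursat_rightKernel_normal h1 hmul hsnd).2.1, (goursat_rightKernel_normal h1 hmul hsnd).2.2,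
      ⟨c, by simpa using hc, hc1, hcc⟩⟩ x
    simpa using h
  intro a
  obtain ⟨c, hac⟩ := hfst a
  -- `x = c⁻¹ a`
  rcases perm_cube_or_transposition (c⁻¹ * a) with hx | ⟨hx, hx1⟩
  · -- `x ∈ A₃ ⊆` right kernel: `(a, c) · (1, x) = (a, a)`
    have h := hmul _ _ _ _ (hK₂ _ hx) hac
    simpa using h
  · rcases perm_transposition_split a c hx with hx0 | ⟨haa, ha1, hccc⟩ | ⟨haaa, hcc, hc1⟩
    · exact absurd hx0 hx1
    · -- `a` a transposition, `c³ = 1`: `(a,c)³ = (a, 1)`, so the left kernel is everything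
      have h3 := goursat_pow h1 hmul hac 3
      rw [show a ^ 3 = a * a * a by simp [pow_succ, mul_assoc], show c ^ 3 = c * c * c by simp [pow_succ, mul_assoc],
        haa, one_mul, hccc] at h3
      have hall := hU₁ a ha1 haa h3
      obtain ⟨b, hb⟩ := hsnd a
      -- `(a b⁻¹, 1) · (b, a) = (a, a)`
      have h := hmul _ _ _ _ hb (hall (a * b⁻¹))
      simpa using h
    · -- `c` a transposition, `a³ = 1`: `(a,c)³ = (1, c)`, so the right kernel is everything
      have h3 := goursat_pow h1 hmul hac 3
      rw [show a ^ 3 = a * a * a by simp [pow_succ, mul_assoc], show c ^ 3 = c * c * c by simp [pow_succ, mul_assoc],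
        haaa, hcc, one_mul] at h3
      have hall := hU₂ c hc1 hcc h3
      -- `(1, a c⁻¹) · (a, c) = (a, a)`
      have h := hmul _ _ _ _ hac (hall (a * c⁻¹))
      simpa using h

end Goursat

/-! ## §3 Two non-Galois sextic fields: joint realisation of the fibre permutations -/

section Joint

variable {K₁ K₂ : Type} [Field K₁] [NumberField K₁] [IsCMField K₁] [Field K₂] [NumberField K₂] [IsCMField K₂]
  {k : Type} [Field k] {i₁ : k →+* K₁} {i₂ : k →+* K₂} {τ : k →+* ℂ}
  (hττ : ComplexEmbedding.conjugate τ ≠ τ)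
  (hdich₁ : ∀ s : K₁ →+* ℂ, s.comp i₁ = τ ∨ s.comp i₁ = ComplexEmbedding.conjugate τ)
  (hdich₂ : ∀ s : K₂ →+* ℂ, s.comp i₂ = τ ∨ s.comp i₂ = ComplexEmbedding.conjugate τ)
  {t₁ : ZMod 3 → (K₁ →+* ℂ)} (ht₁ : Function.Injective t₁) (hti₁ : ∀ p, (t₁ p).comp i₁ = τ)
  (htcov₁ : ∀ s : K₁ →+* ℂ, s.comp i₁ = τ → ∃ p, s = t₁ p)
  {t₂ : ZMod 3 → (K₂ →+* ℂ)} (ht₂ : Function.Injective t₂) (hti₂ : ∀ p, (t₂ p).comp i₂ = τ)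
  (htcov₂ : ∀ s : K₂ →+* ℂ, s.comp i₂ = τ → ∃ p, s = t₂ p)

omit [NumberField K₁] [IsCMField K₁] in
include hti₁ in
/-- An automorphism carrying one member of the `τ`-fibre of `K₁` to another fixes `τ`. [folklore] -/
theorem comp_eq_self_of_comp_t₁ {σ : ℂ ≃+* ℂ} {p q : ZMod 3} (h : (σ : ℂ →+* ℂ).comp (t₁ p) = t₁ q) :
    (σ : ℂ →+* ℂ).comp τ = τ := by
  calc (σ : ℂ →+* ℂ).comp τ = (σ : ℂ →+* ℂ).comp ((t₁ p).comp i₁) := by rw [hti₁ p]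
    _ = ((σ : ℂ →+* ℂ).comp (t₁ p)).comp i₁ := by rw [RingHom.comp_assoc]
    _ = τ := by rw [h, hti₁ q]

include hττ hdich₁ hdich₂ ht₁ hti₁ htcov₁ ht₂ hti₂ htcov₂ in
/-- **JOINT REALISATION.**  For two NON-Galois sextic fields `K₁`, `K₂` over `(k, τ)` whose `τ`-fibres are enumerated by
`t₁`, `t₂`, and such that some automorphism of `ℂ` fixes the fibre of `K₂` pointwise while moving that of `K₁` and vice
versa (`hsep₁`, `hsep₂`), every permutation `π` of `ℤ/3` is realised SIMULTANEOUSLY on both fibres by one automorphism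
of `ℂ`.  Proof: the realised pairs `(π₁, π₂)` form a relation `J ⊆ S₃ × S₃` with `(1,1)`, closed under products
(compose), both projections onto (single-field realisation `NonGaloisField.exists_ringEquiv_forall_comp_eq_perm` plus
`exists_perm_of_comp_eq` for the other fibre) and non-trivial kernels (`hsep`); Goursat (§2).
[cite: Lang2002, I §12 Exercise 5 and VI §1 Thm. 1.14] [cite: Shimura1998, §18.2 Lemma (i)] -/
theorem exists_ringEquiv_forall_comp_eq_perm₂ (hK₁ : ¬ IsGalois ℚ K₁) (hK₂ : ¬ IsGalois ℚ K₂)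
    (hsep₁ : ∃ σ : ℂ ≃+* ℂ, (∀ p, (σ : ℂ →+* ℂ).comp (t₂ p) = t₂ p) ∧ ∃ p, (σ : ℂ →+* ℂ).comp (t₁ p) ≠ t₁ p)
    (hsep₂ : ∃ σ : ℂ ≃+* ℂ, (∀ p, (σ : ℂ →+* ℂ).comp (t₁ p) = t₁ p) ∧ ∃ p, (σ : ℂ →+* ℂ).comp (t₂ p) ≠ t₂ p)
    (π : Equiv.Perm (ZMod 3)) :
    ∃ σ : ℂ ≃+* ℂ, (∀ p, (σ : ℂ →+* ℂ).comp (t₁ p) = t₁ (π p)) ∧ (∀ p, (σ : ℂ →+* ℂ).comp (t₂ p) = t₂ (π p)) := by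
  -- the relation of jointly realised pairs
  let J : Equiv.Perm (ZMod 3) → Equiv.Perm (ZMod 3) → Prop := fun π₁ π₂ =>
    ∃ σ : ℂ ≃+* ℂ, (∀ p, (σ : ℂ →+* ℂ).comp (t₁ p) = t₁ (π₁ p)) ∧ (∀ p, (σ : ℂ →+* ℂ).comp (t₂ p) = t₂ (π₂ p))
  have h1 : J 1 1 := ⟨RingEquiv.refl ℂ, fun p => RingHom.ext fun _ => rfl, fun p => RingHom.ext fun _ => rfl⟩
  have hmul : ∀ a c a' c', J a c → J a' c' → J (a' * a) (c' * c) := by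
    rintro a c a' c' ⟨σ, hσ₁, hσ₂⟩ ⟨σ', hσ'₁, hσ'₂⟩
    refine ⟨σ.trans σ', fun p => ?_, fun p => ?_⟩
    · have hc : ((σ.trans σ' : ℂ ≃+* ℂ) : ℂ →+* ℂ).comp (t₁ p) = (σ' : ℂ →+* ℂ).comp ((σ : ℂ →+* ℂ).comp (t₁ p)) :=
        RingHom.ext fun _ => rfl
      rw [hc, hσ₁, hσ'₁, Equiv.Perm.mul_apply]
    · have hc : ((σ.trans σ' : ℂ ≃+* ℂ) : ℂ →+* ℂ).comp (t₂ p) = (σ' : ℂ →+* ℂ).comp ((σ : ℂ →+* ℂ).comp (t₂ p)) :=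
        RingHom.ext fun _ => rfl
      rw [hc, hσ₂, hσ'₂, Equiv.Perm.mul_apply]
  -- both projections are onto
  have hfst : ∀ a, ∃ c, J a c := by
    intro a
    obtain ⟨σ, hσ⟩ := exists_ringEquiv_forall_comp_eq_perm hττ hdich₁ ht₁ hti₁ htcov₁ hK₁ a
    obtain ⟨c, hc⟩ := exists_perm_of_comp_eq ht₂ hti₂ htcov₂ (comp_eq_self_of_comp_t₁ hti₁ (hσ 0))
    exact ⟨c, σ, hσ, hc⟩
  have hsnd : ∀ c, ∃ a, J a c := by
    intro c
    obtain ⟨σ, hσ⟩ := exists_ringEquiv_forall_comp_eq_perm hττ hdich₂ ht₂ hti₂ htcov₂ hK₂ c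
    obtain ⟨a, ha⟩ := exists_perm_of_comp_eq ht₁ hti₁ htcov₁ (comp_eq_self_of_comp_t₁ hti₂ (hσ 0))
    exact ⟨a, σ, ha, hσ⟩
  -- both kernels are non-trivial
  have hN₁ : ∃ a, a ≠ 1 ∧ J a 1 := by
    obtain ⟨σ, hfix, p₀, hmove⟩ := hsep₁
    obtain ⟨a, ha⟩ := exists_perm_of_comp_eq ht₁ hti₁ htcov₁ (comp_eq_self_of_comp_t₁ hti₂ (hfix 0))
    refine ⟨a, fun ha1 => hmove ?_, σ, ha, fun p => by rw [hfix p, Equiv.Perm.one_apply]⟩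
    rw [ha p₀, ha1, Equiv.Perm.one_apply]
  have hN₂ : ∃ c, c ≠ 1 ∧ J 1 c := by
    obtain ⟨σ, hfix, p₀, hmove⟩ := hsep₂
    obtain ⟨c, hc⟩ := exists_perm_of_comp_eq ht₂ hti₂ htcov₂ (comp_eq_self_of_comp_t₁ hti₁ (hfix 0))
    refine ⟨c, fun hc1 => hmove ?_, σ, fun p => by rw [hfix p, Equiv.Perm.one_apply], hc⟩
    rw [hc p₀, hc1, Equiv.Perm.one_apply]
  exact forall_diag_of_subdirect h1 hmul hfst hsnd hN₁ hN₂ π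

/-! ## §4 The frame form: the joint Galois hypothesis `he_gal` -/

include hττ hdich₁ hdich₂ ht₁ hti₁ htcov₁ ht₂ hti₂ htcov₂ in
/-- **The joint Galois hypothesis of the two-field assembly.**  In frames `e₁`, `e₂` of `K₁`, `K₂` adapted to the
enumerations (`e_m (t_m p) = (p, true)`, `e_m ((t_m p)‾) = (p, false)`, every embedding being `t_m p` or `(t_m p)‾`),
each of the six sign-preserving moves `(p, b) ↦ (±p + j, b)` is realised on `Hom(K₁, ℂ)` AND `Hom(K₂, ℂ)` by ONE
automorphism of `ℂ`. [cite: Lang2002, VI §1 Thm. 1.14] [cite: Shimura1998, §18.2 Lemma (i)] -/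
theorem exists_joint_he_gal (hK₁ : ¬ IsGalois ℚ K₁) (hK₂ : ¬ IsGalois ℚ K₂)
    (hsep₁ : ∃ σ : ℂ ≃+* ℂ, (∀ p, (σ : ℂ →+* ℂ).comp (t₂ p) = t₂ p) ∧ ∃ p, (σ : ℂ →+* ℂ).comp (t₁ p) ≠ t₁ p)
    (hsep₂ : ∃ σ : ℂ ≃+* ℂ, (∀ p, (σ : ℂ →+* ℂ).comp (t₁ p) = t₁ p) ∧ ∃ p, (σ : ℂ →+* ℂ).comp (t₂ p) ≠ t₂ p)
    {e₁ : (K₁ →+* ℂ) ≃ ZMod 3 × Bool} {e₂ : (K₂ →+* ℂ) ≃ ZMod 3 × Bool}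
    (het₁ : ∀ p, e₁ (t₁ p) = (p, true)) (hec₁ : ∀ p, e₁ (ComplexEmbedding.conjugate (t₁ p)) = (p, false))
    (hcases₁ : ∀ s : K₁ →+* ℂ, ∃ p, s = t₁ p ∨ s = ComplexEmbedding.conjugate (t₁ p))
    (het₂ : ∀ p, e₂ (t₂ p) = (p, true)) (hec₂ : ∀ p, e₂ (ComplexEmbedding.conjugate (t₂ p)) = (p, false))
    (hcases₂ : ∀ s : K₂ →+* ℂ, ∃ p, s = t₂ p ∨ s = ComplexEmbedding.conjugate (t₂ p))
    (j : ZMod 3) (f : Bool) :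
    ∃ σ : ℂ ≃+* ℂ,
      (∀ s : K₁ →+* ℂ, e₁ ((σ : ℂ →+* ℂ).comp s) = ((if f then -(e₁ s).1 else (e₁ s).1) + j, (e₁ s).2)) ∧
      (∀ s : K₂ →+* ℂ, e₂ ((σ : ℂ →+* ℂ).comp s) = ((if f then -(e₂ s).1 else (e₂ s).1) + j, (e₂ s).2)) := by
  set π : Equiv.Perm (ZMod 3) := (if f then Equiv.neg (ZMod 3) else Equiv.refl (ZMod 3)).trans
    (Equiv.addRight j) with hπ
  have hπp : ∀ p, π p = (if f then -p else p) + j := fun p => by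
    rw [hπ]; cases f <;> rfl
  obtain ⟨σ, hσ₁, hσ₂⟩ :=
    exists_ringEquiv_forall_comp_eq_perm₂ hττ hdich₁ hdich₂ ht₁ hti₁ htcov₁ ht₂ hti₂ htcov₂ hK₁ hK₂ hsep₁ hsep₂ π
  refine ⟨σ, fun s => ?_, fun s => ?_⟩
  · obtain ⟨p, rfl | rfl⟩ := hcases₁ s
    · rw [hσ₁ p, het₁, het₁, hπp]
    · rw [comp_conjugate, hσ₁ p, hec₁, hec₁, hπp]
  · obtain ⟨p, rfl | rfl⟩ := hcases₂ s
    · rw [hσ₂ p, het₂, het₂, hπp]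
    · rw [comp_conjugate, hσ₂ p, hec₂, hec₂, hπp]

end Joint

end Summit.HodgeConjecture.CorCM.TwoSexticFields

end
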